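import Summits.QuantumFields.BalabanUV.T4Continuum.Support.NE7FreeLandauStep
import Summits.QuantumFields.BalabanUV.T4Continuum.Support.NE7BoxLandauSupAPriori
import HarnessLib

/-!
# NE7 — THE INVARIANT OF THE INCREMENTAL CONSTRUCTION: a small exact free-boundary Landau gauge for the links `e^{sB}` on the box propagates to
# parameter `s + δ` — one minimisation step (F312c) followed by the a priori sup estimate (F309b) restores the sup letter `‖A‖ ≤ ρ⋆∕2` (F313a)

Cell `pub-balaban`, rung (B)+1 sub-cell t4, lineage `b2b-balaban-t4-ne7-p1` (CRUX PROVER NE7 #1 = OWNER of row NE7), generation 93; memo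
`t4/b2b-balaban-t4-ne7-p1-g93/UHLENBECK-ROAD.md` §5.  Over F312c `NE7FreeLandauStep.freeLandau_step` (existence of the next Landau gauge in a `θ`-ball),
F309b `NE7BoxLandauSupAPriori.landau_box_sup_le'` (a priori sup letter `≤ 64d³M(ε + 36ρ²)`), F312b (link letters) and `MatrixLog.exists_isHermitian_exp_eq`.

THE INVARIANT `I(s)`: a unitary site gauge `g` (`= 1` off the box, `g 0 = 1`) and a skew log `A` of the gauged links, `e^{A(x,κ)} = g_x e^{sB(x,κ)} g_{x+e_κ}ᴴ`
on the box bonds, with `‖A‖ ≤ ρ⋆∕2` and the free-boundary lattice Landau condition at every box site.  THE STEP `I(s) ⟹ I(s+δ)` under four explicit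
inequalities (C1) chart: `(π∕2)((1+θ)²e^{ρ⋆∕2}e^{δb₀} − 1) ≤ ρ⋆`; (C2) a priori: `64d³M(ε′ + 36ρ⋆²) ≤ ρ⋆∕2`, `ρ⋆ ≤ ¼`; (C3) regime and (C4) smallness of
F312c with `v₀ = e^{ρ⋆∕2}e^{δb₀} − 1`, `e₀ = 4d(e^{δb₀} − 1)`.  Here `ε′` bounds the plaquettes of `e^{(s+δ)B}` on the box and `b₀` bounds `‖B‖`.
(C2)–(C3) are the `M²ε′ ≪ 1` regime; (C1), (C4) hold for `θ`, `δ` small depending on `M` — chosen once in F313b, uniformly in the step.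

WHAT ([folklore]; 0 def, 0 sorry): `norm_unitary_conj_sub_one`, `plaq_gauged_eq`, **`invariant_step`**.
HONEST FRAMING (page 1): a lattice-gauge lemma for ARBITRARY skew `B` on a box; nothing of Bałaban's asserted; NE7 NOT PROVED here; spine 0∕9; finite T⁴
rung (B)+1 — NOT infinite volume, NOT mass gap, NOT `BetaPertH`, NOT Clay.  No `sorry`; axioms ⊆ {propext, Classical.choice, Quot.sound}.
-/

set_option autoImplicit false

open scoped BigOperators Matrix Matrix.Norms.L2Operator
open Finset NormedSpace Set

namespace Summit.QuantumFields.BalabanUV.T4Continuum.NE7LatticeUhlenbeckInvariant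

open Literature.MathematicalPhysics.QuantumFieldTheory.Balaban1983to89
open B7Prop1Explicit UnitaryModel MatrixNorms
open T4AveragingDeficitWallBoundary (periodBox mem_periodBox)
open NE7GradientCurrency (norm_mul_sub_one_le_of_le norm_exp_sub_one_le)
open NE7FreeLandauSegment (norm_EL_sub_EL_le)
open NE7FreeLandauStep (freeLandau_step)
open NE7BoxLandauSupAPriori (landau_box_sup_le')

noncomputable section

variable {d : ℕ} {n : Type*} [Fintype n] [DecidableEq n] [Nonempty n]

/-! ## §1 Unitary conjugation bookkeeping -/

omit [Nonempty n] in
/-- `‖gXhᴴ − ghᴴ‖ = ‖X − 1‖`-type bound: for unitary `g, h`, `‖g X hᴴ − g hᴴ‖ ≤ ‖X − 1‖`, and in particular `‖gXgᴴ − 1‖ ≤ ‖X − 1‖`. [folklore] -/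
theorem norm_unitary_conj_sub_one {g X : Matrix n n ℂ} (hg : g ∈ Matrix.unitaryGroup n ℂ) : ‖g * X * gᴴ - 1‖ ≤ ‖X - 1‖ := by
  letI : CStarAlgebra (Matrix n n ℂ) := {}
  have hg' : g ∈ unitary (Matrix n n ℂ) := hg
  have hgg : g * gᴴ = 1 := by rw [← Matrix.star_eq_conjTranspose]; exact Unitary.mul_star_self_of_mem hg'
  have h1 : g * X * gᴴ - 1 = g * ((X - 1) * gᴴ) := by
    calc g * X * gᴴ - 1 = g * X * gᴴ - g * gᴴ := by rw [hgg]
      _ = g * ((X - 1) * gᴴ) := by noncomm_ring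
  rw [h1, CStarRing.norm_mem_unitary_mul _ hg', ← Matrix.star_eq_conjTranspose, CStarRing.norm_mul_mem_unitary _ (Unitary.star_mem hg')]

omit [Nonempty n] in
/-- **THE PLAQUETTE OF GAUGED LINKS IS THE CONJUGATED PLAQUETTE**: for unitary `g`,
`(g_xV₁g_1ᴴ)(g_1V₂g_2ᴴ)(g_3V₃g_2ᴴ)ᴴ(g_xV₄g_3ᴴ)ᴴ = g_x (V₁V₂V₃ᴴV₄ᴴ) g_xᴴ`. [folklore] -/
theorem plaq_gauged_eq {gx g1 g2 g3 V₁ V₂ V₃ V₄ : Matrix n n ℂ} (h1 : g1 ∈ Matrix.unitaryGroup n ℂ) (h2 : g2 ∈ Matrix.unitaryGroup n ℂ)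
    (h3 : g3 ∈ Matrix.unitaryGroup n ℂ) :
    (gx * V₁ * g1ᴴ) * (g1 * V₂ * g2ᴴ) * (g3 * V₃ * g2ᴴ)ᴴ * (gx * V₄ * g3ᴴ)ᴴ = gx * (V₁ * V₂ * V₃ᴴ * V₄ᴴ) * gxᴴ := by
  have u1 : g1ᴴ * g1 = 1 := by rw [← Matrix.star_eq_conjTranspose]; exact Unitary.star_mul_self_of_mem (h1 : g1 ∈ unitary _)
  have u2 : g2ᴴ * g2 = 1 := by rw [← Matrix.star_eq_conjTranspose]; exact Unitary.star_mul_self_of_mem (h2 : g2 ∈ unitary _)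
  have u3 : g3ᴴ * g3 = 1 := by rw [← Matrix.star_eq_conjTranspose]; exact Unitary.star_mul_self_of_mem (h3 : g3 ∈ unitary _)
  calc (gx * V₁ * g1ᴴ) * (g1 * V₂ * g2ᴴ) * (g3 * V₃ * g2ᴴ)ᴴ * (gx * V₄ * g3ᴴ)ᴴ
      = gx * V₁ * (g1ᴴ * g1) * V₂ * (g2ᴴ * g2) * V₃ᴴ * (g3ᴴ * g3) * V₄ᴴ * gxᴴ := by
        simp only [Matrix.conjTranspose_mul, Matrix.conjTranspose_conjTranspose]; noncomm_ring
    _ = gx * (V₁ * V₂ * V₃ᴴ * V₄ᴴ) * gxᴴ := by rw [u1, u2, u3]; noncomm_ring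

/-- **THE A PRIORI LETTER, PERIOD-BOX FORM**: F309b `landau_box_sup_le'` at `lo = 0` with the box predicates written as membership in `periodBox M`.
[folklore] -/
theorem landau_box_sup_le_periodBox (hd : 1 ≤ d) {M : ℕ} (hM : 2 ≤ M) (A : Site d → Fin d → Matrix n n ℂ) {ρ ε : ℝ} (hε : 0 ≤ ε)
    (hρ4 : ρ ≤ 1 / 4)
    (hA : ∀ (y : Site d) (κ : Fin d), y ∈ periodBox (d := d) M → y + e κ ∈ periodBox (d := d) M → ‖A y κ‖ ≤ ρ)
    (hplaq : ∀ (q : Site d) (μ ν : Fin d), μ ≠ ν → q ∈ periodBox (d := d) M → q + e μ ∈ periodBox (d := d) M →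
      q + e ν ∈ periodBox (d := d) M → q + e μ + e ν ∈ periodBox (d := d) M →
      ‖exp (A q μ) * exp (A (q + e μ) ν) * exp (-A (q + e ν) μ) * exp (-A q ν) - 1‖ ≤ ε)
    (hEL : ∀ y ∈ periodBox (d := d) M, ∑ κ : Fin d,
      ((if y + e κ ∈ periodBox (d := d) M then (exp (A y κ) - exp (-A y κ)) else 0)
        - (if y - e κ ∈ periodBox (d := d) M then (exp (A (y - e κ) κ) - exp (-A (y - e κ) κ)) else 0)) = 0)
    {x : Site d} {κ : Fin d} (hx : x ∈ periodBox (d := d) M) (hxκ : x + e κ ∈ periodBox (d := d) M) :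
    ‖A x κ‖ ≤ 64 * (d : ℝ) ^ 3 * M * (ε + 36 * ρ ^ 2) := by
  have hmem : ∀ y : Site d, y ∈ periodBox (d := d) M ↔ ∀ i, (0 : Site d) i ≤ y i ∧ y i < (0 : Site d) i + (M : ℤ) := by
    intro y; rw [mem_periodBox]; simp only [Pi.zero_apply, zero_add]
  refine landau_box_sup_le' (n := n) hd hM (0 : Site d) A hε hρ4 (fun y κ' hy hyκ => hA y κ' ((hmem y).2 hy) ((hmem _).2 hyκ))
    (fun q μ ν hμν hq hqμ hqν hqμν => hplaq q μ ν hμν ((hmem q).2 hq) ((hmem _).2 hqμ) ((hmem _).2 hqν) ((hmem _).2 hqμν))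
    (fun y hy => ?_) ((hmem x).1 hx) ((hmem _).1 hxκ)
  refine (Finset.sum_congr rfl fun κ' _ => ?_).trans (hEL y ((hmem y).2 hy))
  rw [if_congr (hmem (y + e κ')) rfl rfl, if_congr (hmem (y - e κ')) rfl rfl]

/-! ## §2 The invariant step -/

set_option maxHeartbeats 3200000 in
/-- **THE INVARIANT PROPAGATES FROM `s` TO `s + δ`** (`d ≥ 1`, `m ≥ 1`, box `periodBox (m+1)`).  Data: a skew bond field `B` with `‖B‖ ≤ b₀`; parameters
`0 ≤ s`, `0 ≤ δ`; the plaquettes of `e^{(s+δ)B}` on the box within `ε′` of `1`; radii `ρ⋆ ≤ ¼`, `θ > 0` satisfying (C1)–(C4) of the module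
docstring.  Hypothesis `I(s)`: a unitary gauge `g` (`= 1` off the box, `g 0 = 1`) and a skew `A` with `e^{A} = g e^{sB} gᴴ` bondwise on the box,
`‖A‖ ≤ ρ⋆∕2`, and the free-boundary Landau condition.  Conclusion: `I(s+δ)`. [folklore] -/
theorem invariant_step (hd : 1 ≤ d) {m : ℕ} (hm : 1 ≤ m) (B : Site d → Fin d → Matrix n n ℂ) (hBskew : ∀ x κ, B x κ ∈ skewAdjoint (Matrix n n ℂ))
    {b₀ : ℝ} (hB : ∀ x κ, ‖B x κ‖ ≤ b₀) {s δ ε' ρs θ : ℝ} (hδ : 0 ≤ δ) (hε' : 0 ≤ ε') (hρs4 : ρs ≤ 1 / 4) (hθ : 0 < θ)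
    (hplaq : ∀ (q : Site d) (μ ν : Fin d), μ ≠ ν → q ∈ periodBox (d := d) (m + 1) → q + e μ ∈ periodBox (d := d) (m + 1) →
      q + e ν ∈ periodBox (d := d) (m + 1) → q + e μ + e ν ∈ periodBox (d := d) (m + 1) →
      ‖exp (((s + δ : ℝ) : ℂ) • B q μ) * exp (((s + δ : ℝ) : ℂ) • B (q + e μ) ν) * (exp (((s + δ : ℝ) : ℂ) • B (q + e ν) μ))ᴴ
          * (exp (((s + δ : ℝ) : ℂ) • B q ν))ᴴ - 1‖ ≤ ε')
    -- (C1) the chart condition, (C2) the a priori condition, (C3) the regime, (C4) the smallness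
    (hC1 : Real.pi / 2 * ((1 + θ) * (Real.exp (ρs / 2) * Real.exp (δ * b₀)) * (1 + θ) - 1) ≤ ρs)
    (hC2 : 64 * (d : ℝ) ^ 3 * ((m + 1 : ℕ) : ℝ) * (ε' + 36 * ρs ^ 2) ≤ ρs / 2)
    (hC3 : (Fintype.card n : ℝ) * (Real.exp (2 * (Real.pi / 2 * θ)) * (1 + (Real.exp (ρs / 2) * Real.exp (δ * b₀) - 1)) - 1)
      + 2 * (Fintype.card n : ℝ) * d * (m + 1) * (Real.exp (2 * (Real.pi / 2 * θ)) * (1 + (Real.exp (ρs / 2) * Real.exp (δ * b₀) - 1)) - 1) ≤ 1 / 2)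
    (hC4 : (1 / 2) * (((m + 1 : ℕ) : ℝ) ^ d * ((Real.pi / 2 * θ) * (4 * d * (Real.exp (δ * b₀) - 1))))
      + (1 / 2) * ((Real.pi / 2 * θ) ^ 2 * ((m + 1 : ℕ) : ℝ) ^ d * ((4 * d * (Real.exp (δ * b₀) - 1))
        + 4 * d * ((1 + (Real.exp (ρs / 2) * Real.exp (δ * b₀) - 1)) * (Real.exp (2 * (Real.pi / 2 * θ)) - 1))))
      < θ ^ 2 / (4 * (Fintype.card n : ℝ) * d ^ 2 * m ^ 2))
    -- the invariant at `s`
    (g : Site d → Matrix n n ℂ) (hgu : ∀ x, g x ∈ Matrix.unitaryGroup n ℂ) (hg1 : ∀ x, x ∉ periodBox (d := d) (m + 1) → g x = 1) (hg0 : g 0 = 1)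
    (A : Site d → Fin d → Matrix n n ℂ)
    (hAskew : ∀ (x : Site d) (κ : Fin d), x ∈ periodBox (d := d) (m + 1) → x + e κ ∈ periodBox (d := d) (m + 1) → A x κ ∈ skewAdjoint (Matrix n n ℂ))
    (hAexp : ∀ (x : Site d) (κ : Fin d), x ∈ periodBox (d := d) (m + 1) → x + e κ ∈ periodBox (d := d) (m + 1) →
      exp (A x κ) = g x * exp ((s : ℂ) • B x κ) * (g (x + e κ))ᴴ)
    (hAρ : ∀ (x : Site d) (κ : Fin d), x ∈ periodBox (d := d) (m + 1) → x + e κ ∈ periodBox (d := d) (m + 1) → ‖A x κ‖ ≤ ρs / 2)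
    (hELA : ∀ y ∈ periodBox (d := d) (m + 1), ∑ κ : Fin d,
      ((if y + e κ ∈ periodBox (d := d) (m + 1) then (exp (A y κ) - exp (-A y κ)) else 0)
        - (if y - e κ ∈ periodBox (d := d) (m + 1) then (exp (A (y - e κ) κ) - exp (-A (y - e κ) κ)) else 0)) = 0) :
    ∃ (g' : Site d → Matrix n n ℂ) (A' : Site d → Fin d → Matrix n n ℂ), (∀ x, g' x ∈ Matrix.unitaryGroup n ℂ) ∧
      (∀ x, x ∉ periodBox (d := d) (m + 1) → g' x = 1) ∧ g' 0 = 1 ∧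
      (∀ (x : Site d) (κ : Fin d), x ∈ periodBox (d := d) (m + 1) → x + e κ ∈ periodBox (d := d) (m + 1) → A' x κ ∈ skewAdjoint (Matrix n n ℂ)) ∧
      (∀ (x : Site d) (κ : Fin d), x ∈ periodBox (d := d) (m + 1) → x + e κ ∈ periodBox (d := d) (m + 1) →
        exp (A' x κ) = g' x * exp (((s + δ : ℝ) : ℂ) • B x κ) * (g' (x + e κ))ᴴ) ∧
      (∀ (x : Site d) (κ : Fin d), x ∈ periodBox (d := d) (m + 1) → x + e κ ∈ periodBox (d := d) (m + 1) → ‖A' x κ‖ ≤ ρs / 2) ∧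
      (∀ y ∈ periodBox (d := d) (m + 1), ∑ κ : Fin d,
        ((if y + e κ ∈ periodBox (d := d) (m + 1) then (exp (A' y κ) - exp (-A' y κ)) else 0)
          - (if y - e κ ∈ periodBox (d := d) (m + 1) then (exp (A' (y - e κ) κ) - exp (-A' (y - e κ) κ)) else 0)) = 0) := by
  letI : CStarAlgebra (Matrix n n ℂ) := {}
  letI : NormedAlgebra ℚ (Matrix n n ℂ) := NormedAlgebra.restrictScalars ℚ ℂ (Matrix n n ℂ)
  set pB := periodBox (d := d) (m + 1) with hpB
  have hb₀ : 0 ≤ b₀ := (norm_nonneg _).trans (hB 0 ⟨0, hd⟩)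
  have hρs0 : 0 ≤ ρs := by
    have h0 : (0 : Site d) ∈ pB := mem_periodBox.2 fun κ => ⟨le_rfl, by simp only [Pi.zero_apply]; exact_mod_cast Nat.succ_pos m⟩
    have h0e : (0 : Site d) + e ⟨0, hd⟩ ∈ pB := by
      rw [zero_add, mem_periodBox]; intro κ
      rw [e_apply]
      split_ifs
      · exact ⟨zero_le_one, by push_cast; omega⟩
      · exact ⟨le_rfl, by exact_mod_cast Nat.succ_pos m⟩
    linarith [norm_nonneg (A 0 ⟨0, hd⟩), hAρ 0 ⟨0, hd⟩ h0 h0e]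
  -- skew scalar multiples of `B` and their exponentials
  have hsB : ∀ (r : ℝ) (x : Site d) (κ : Fin d), ((r : ℂ) • B x κ) ∈ skewAdjoint (Matrix n n ℂ) := fun r x κ => by
    have h := skewAdjoint.smul_mem r (hBskew x κ); rwa [← Complex.coe_smul] at h
  have hexpU : ∀ (r : ℝ) (x : Site d) (κ : Fin d), exp ((r : ℂ) • B x κ) ∈ Matrix.unitaryGroup n ℂ := fun r x κ =>
    NormedSpace.exp_mem_unitary_of_mem_skewAdjoint (hsB r x κ)
  have hexpH : ∀ (r : ℝ) (x : Site d) (κ : Fin d), (exp ((r : ℂ) • B x κ))ᴴ = exp (-((r : ℂ) • B x κ)) := fun r x κ => by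
    have h1 : ((r : ℂ) • B x κ)ᴴ = -((r : ℂ) • B x κ) := by rw [← Matrix.star_eq_conjTranspose]; exact skewAdjoint.mem_iff.1 (hsB r x κ)
    rw [← Matrix.exp_conjTranspose, h1]
  -- the current links and the links at `s + δ` in the current gauge
  set W : Site d → Fin d → Matrix n n ℂ := fun x κ => g x * exp ((s : ℂ) • B x κ) * (g (x + e κ))ᴴ with hW
  set V : Site d → Fin d → Matrix n n ℂ := fun x κ => g x * exp (((s + δ : ℝ) : ℂ) • B x κ) * (g (x + e κ))ᴴ with hV
  have hgu' : ∀ x, g x ∈ unitary (Matrix n n ℂ) := hgu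
  have hWu : ∀ x κ, W x κ ∈ unitary (Matrix n n ℂ) := fun x κ =>
    (unitary _).mul_mem ((unitary _).mul_mem (hgu' x) (hexpU s x κ)) (by rw [← Matrix.star_eq_conjTranspose]; exact Unitary.star_mem (hgu' _))
  -- `V = W · (g' e^{δB} g'ᴴ)`
  have hVW : ∀ x κ, V x κ = W x κ * (g (x + e κ) * exp ((δ : ℂ) • B x κ) * (g (x + e κ))ᴴ) := by
    intro x κ
    have hsplit : exp (((s + δ : ℝ) : ℂ) • B x κ) = exp ((s : ℂ) • B x κ) * exp ((δ : ℂ) • B x κ) := by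
      rw [Complex.ofReal_add, add_smul]
      exact exp_add_of_commute ((Commute.refl (B x κ)).smul_left _ |>.smul_right _)
    have hgg : (g (x + e κ))ᴴ * g (x + e κ) = 1 := by
      rw [← Matrix.star_eq_conjTranspose]; exact Unitary.star_mul_self_of_mem (hgu' _)
    simp only [hV, hW, hsplit]
    calc g x * (exp ((s : ℂ) • B x κ) * exp ((δ : ℂ) • B x κ)) * (g (x + e κ))ᴴ
        = g x * exp ((s : ℂ) • B x κ) * ((g (x + e κ))ᴴ * g (x + e κ)) * exp ((δ : ℂ) • B x κ) * (g (x + e κ))ᴴ := by rw [hgg]; noncomm_ring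
      _ = _ := by noncomm_ring
  -- letters of `V`: distance to `1` and to `W`
  set v₀ : ℝ := Real.exp (ρs / 2) * Real.exp (δ * b₀) - 1 with hv₀_def
  have hexpδ : ∀ x κ, ‖exp ((δ : ℂ) • B x κ) - 1‖ ≤ Real.exp (δ * b₀) - 1 := fun x κ =>
    norm_exp_sub_one_le (by rw [norm_smul, Complex.norm_real, Real.norm_eq_abs, abs_of_nonneg hδ]; exact mul_le_mul_of_nonneg_left (hB x κ) hδ)
  have hW1 : ∀ (x : Site d) (κ : Fin d), x ∈ pB → x + e κ ∈ pB → ‖W x κ - 1‖ ≤ Real.exp (ρs / 2) - 1 := by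
    intro x κ hx hxκ
    rw [show W x κ = exp (A x κ) from (hAexp x κ hx hxκ).symm]
    exact norm_exp_sub_one_le (hAρ x κ hx hxκ)
  have hconjδ : ∀ x κ, ‖g (x + e κ) * exp ((δ : ℂ) • B x κ) * (g (x + e κ))ᴴ - 1‖ ≤ Real.exp (δ * b₀) - 1 := fun x κ =>
    (norm_unitary_conj_sub_one (hgu _)).trans (hexpδ x κ)
  have hv₀0 : 0 ≤ v₀ := by
    rw [hv₀_def]; nlinarith [Real.one_le_exp (by positivity : 0 ≤ ρs / 2), Real.one_le_exp (by positivity : 0 ≤ δ * b₀)]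
  have hV1 : ∀ (x : Site d) (κ : Fin d), x ∈ pB → x + e κ ∈ pB → ‖V x κ - 1‖ ≤ v₀ := by
    intro x κ hx hxκ
    rw [hVW]
    have h := norm_mul_sub_one_le_of_le (p := Real.exp (ρs / 2)) (q := Real.exp (δ * b₀)) (by linarith [hW1 x κ hx hxκ]) (by linarith [hconjδ x κ])
    rw [hv₀_def]; exact h
  have hVW' : ∀ (x : Site d) (κ : Fin d), x ∈ pB → x + e κ ∈ pB → ‖V x κ - W x κ‖ ≤ Real.exp (δ * b₀) - 1 := by
    intro x κ hx hxκ
    rw [hVW, show W x κ * (g (x + e κ) * exp ((δ : ℂ) • B x κ) * (g (x + e κ))ᴴ) - W x κ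
      = W x κ * (g (x + e κ) * exp ((δ : ℂ) • B x κ) * (g (x + e κ))ᴴ - 1) by noncomm_ring, CStarRing.norm_mem_unitary_mul _ (hWu x κ)]
    exact hconjδ x κ
  -- the Euler–Lagrange defect of `V`
  set e₀ : ℝ := 4 * d * (Real.exp (δ * b₀) - 1) with he₀_def
  have hELW : ∀ y ∈ pB, ∑ κ : Fin d, ((if y + e κ ∈ pB then (W y κ - (W y κ)ᴴ) else 0)
      - (if y - e κ ∈ pB then (W (y - e κ) κ - (W (y - e κ) κ)ᴴ) else 0)) = 0 := by
    intro y hy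
    have h := hELA y hy
    have hconv : ∀ (x : Site d) (κ : Fin d), x ∈ pB → x + e κ ∈ pB → exp (A x κ) - exp (-A x κ) = W x κ - (W x κ)ᴴ := by
      intro x κ hx hxκ
      have hsk : (A x κ)ᴴ = -A x κ := by rw [← Matrix.star_eq_conjTranspose]; exact skewAdjoint.mem_iff.1 (hAskew x κ hx hxκ)
      simp only [hW]
      rw [← hAexp x κ hx hxκ, ← Matrix.exp_conjTranspose, hsk]
    refine (Finset.sum_congr rfl fun κ _ => ?_).trans h
    by_cases h1 : y + e κ ∈ pB <;> by_cases h2 : y - e κ ∈ pB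
    · rw [if_pos h1, if_pos h1, if_pos h2, if_pos h2, hconv y κ hy h1, hconv (y - e κ) κ h2 (by rw [sub_add_cancel]; exact hy)]
    · rw [if_pos h1, if_pos h1, if_neg h2, if_neg h2, hconv y κ hy h1]
    · rw [if_neg h1, if_neg h1, if_pos h2, if_pos h2, hconv (y - e κ) κ h2 (by rw [sub_add_cancel]; exact hy)]
    · rw [if_neg h1, if_neg h1, if_neg h2, if_neg h2]
  have hELV : ∀ y ∈ pB, ‖∑ κ : Fin d, ((if y + e κ ∈ pB then (V y κ - (V y κ)ᴴ) else 0)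
      - (if y - e κ ∈ pB then (V (y - e κ) κ - (V (y - e κ) κ)ᴴ) else 0))‖ ≤ e₀ := by
    intro y hy
    have h := norm_EL_sub_EL_le (m + 1) V W (by linarith [Real.one_le_exp (by positivity : 0 ≤ δ * b₀)]) hVW' hy
    rw [hELW y hy, sub_zero] at h
    rw [he₀_def]; exact h
  -- §3 the minimisation step (F312c)
  obtain ⟨hh, hhu, hh1, hh0, hhθ, hELh⟩ := freeLandau_step hd hm V hv₀0 hθ hV1 hELV (by rw [hv₀_def]; exact hC3)
    (by rw [hv₀_def, he₀_def]; exact hC4)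
  -- the new gauge and the new links
  set g' : Site d → Matrix n n ℂ := fun x => hh x * g x with hg'
  have hg'u : ∀ x, g' x ∈ Matrix.unitaryGroup n ℂ := fun x => (unitary _).mul_mem (hhu x) (hgu' x)
  have hg'1 : ∀ x, x ∉ pB → g' x = 1 := fun x hx => by simp only [hg', hh1 x hx, hg1 x hx, one_mul]
  have hg'0 : g' 0 = 1 := by simp only [hg', hh0, hg0, one_mul]
  set W' : Site d → Fin d → Matrix n n ℂ := fun x κ => hh x * V x κ * (hh (x + e κ))ᴴ with hW'
  have hW'eq : ∀ x κ, W' x κ = g' x * exp (((s + δ : ℝ) : ℂ) • B x κ) * (g' (x + e κ))ᴴ := by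
    intro x κ; simp only [hW', hV, hg', Matrix.conjTranspose_mul]; noncomm_ring
  have hW'u : ∀ x κ, W' x κ ∈ unitary (Matrix n n ℂ) := fun x κ => by
    rw [hW'eq]
    exact (unitary _).mul_mem ((unitary _).mul_mem (hg'u x) (hexpU _ x κ)) (by rw [← Matrix.star_eq_conjTranspose]; exact Unitary.star_mem (hg'u _))
  have hW'1 : ∀ (x : Site d) (κ : Fin d), x ∈ pB → x + e κ ∈ pB → ‖W' x κ - 1‖ ≤ (1 + θ) * (1 + v₀) * (1 + θ) - 1 := by
    intro x κ hx hxκ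
    have h1 : ‖hh x - 1‖ ≤ (1 + θ) - 1 := by linarith [hhθ x]
    have h2 : ‖V x κ - 1‖ ≤ (1 + v₀) - 1 := by linarith [hV1 x κ hx hxκ]
    have h3 : ‖(hh (x + e κ))ᴴ - 1‖ ≤ (1 + θ) - 1 := by
      rw [show (hh (x + e κ))ᴴ - 1 = (hh (x + e κ) - 1)ᴴ by rw [Matrix.conjTranspose_sub, Matrix.conjTranspose_one], Matrix.l2_opNorm_conjTranspose]
      linarith [hhθ (x + e κ)]
    exact norm_mul_sub_one_le_of_le (norm_mul_sub_one_le_of_le h1 h2) h3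
  -- §4 the new logarithm
  have hlog : ∀ (x : Site d) (κ : Fin d), ∃ A' : Matrix n n ℂ, A' ∈ skewAdjoint (Matrix n n ℂ) ∧ exp A' = W' x κ ∧ ‖A'‖ ≤ Real.pi / 2 * ‖W' x κ - 1‖ := by
    intro x κ
    obtain ⟨H, hH, -, hexp, -, hup⟩ := MatrixLog.exists_isHermitian_exp_eq (hW'u x κ)
    refine ⟨Complex.I • H, ?_, hexp, ?_⟩
    · rw [skewAdjoint.mem_iff, star_smul, Complex.star_def, Complex.conj_I, Matrix.star_eq_conjTranspose, hH.eq, neg_smul]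
    · have : ‖Complex.I • H‖ = ‖H‖ := by rw [norm_smul, Complex.norm_I, one_mul]
      rw [this]; exact hup
  choose A' hA'skew hA'exp hA'up using hlog
  have hA'ρs : ∀ (x : Site d) (κ : Fin d), x ∈ pB → x + e κ ∈ pB → ‖A' x κ‖ ≤ ρs := by
    intro x κ hx hxκ
    refine (hA'up x κ).trans ((mul_le_mul_of_nonneg_left (hW'1 x κ hx hxκ) (by positivity)).trans ?_)
    rw [hv₀_def]
    have : (1 + (Real.exp (ρs / 2) * Real.exp (δ * b₀) - 1)) = Real.exp (ρs / 2) * Real.exp (δ * b₀) := by ring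
    rw [this]; exact hC1
  -- the Landau condition of `W'` in exponential form
  have hexpH' : ∀ x κ, exp (-A' x κ) = (W' x κ)ᴴ := fun x κ => by
    have h1 : (A' x κ)ᴴ = -A' x κ := by rw [← Matrix.star_eq_conjTranspose]; exact skewAdjoint.mem_iff.1 (hA'skew x κ)
    rw [← hA'exp x κ, ← Matrix.exp_conjTranspose, h1]
  have hELA' : ∀ y ∈ pB, ∑ κ : Fin d, ((if y + e κ ∈ pB then (exp (A' y κ) - exp (-A' y κ)) else 0)
      - (if y - e κ ∈ pB then (exp (A' (y - e κ) κ) - exp (-A' (y - e κ) κ)) else 0)) = 0 := by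
    intro y hy
    have h := hELh y hy
    simp only [hA'exp, hexpH']
    have hW'y : ∀ κ, hh y * V y κ * (hh (y + e κ))ᴴ = W' y κ := fun κ => rfl
    have hW'y' : ∀ κ, hh (y - e κ) * V (y - e κ) κ * (hh (y - e κ + e κ))ᴴ = W' (y - e κ) κ := fun κ => rfl
    simp only [hW'y, hW'y'] at h
    exact h
  -- §5 the a priori estimate (F309b) at radius `ρs`
  have hA'half : ∀ (x : Site d) (κ : Fin d), x ∈ pB → x + e κ ∈ pB → ‖A' x κ‖ ≤ ρs / 2 := by
    intro x κ hx hxκ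
    have hap := landau_box_sup_le_periodBox (n := n) hd (M := m + 1) (by omega) A' (ρ := ρs) (ε := ε') hε' hρs4
      (fun y κ' hy hyκ => hA'ρs y κ' hy hyκ)
      (fun q μ ν hμν hq hqμ hqν hqμν => by
        rw [hexpH', hexpH', hA'exp, hA'exp, hW'eq, hW'eq, hW'eq, hW'eq, show q + e ν + e μ = q + e μ + e ν by abel,
          plaq_gauged_eq (hg'u _) (hg'u _) (hg'u _)]
        exact (norm_unitary_conj_sub_one (hg'u q)).trans (hplaq q μ ν hμν hq hqμ hqν hqμν))
      hELA' hx hxκ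
    exact hap.trans hC2
  exact ⟨g', A', hg'u, hg'1, hg'0, fun x κ _ _ => hA'skew x κ, fun x κ _ _ => by rw [hA'exp, hW'eq], hA'half, hELA'⟩

end

end Summit.QuantumFields.BalabanUV.T4Continuum.NE7LatticeUhlenbeckInvariant
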